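import Literature.Geometry.PolyhedralFans.LinkedRefinementTools
import Literature.Geometry.PolyhedralFans.LinkedRefinement
import Literature.Geometry.PolyhedralFans.LinkBridge
import HarnessLib

/-!
# One synchronised subdivision step of a linked family of fans (KKMS II §2 by charts)

Topic: `Literature/Geometry/PolyhedralFans` (block A5 of the LINKED-KKMS programme; summit
`ResolutionOfSingularities`, W8.1 / Kato (10.4) atlas form). [KempfEtAl1973] Ch. II §2: a
subdivision step of a conical polyhedral complex is performed in every chart at once, at all
points that the chart changes identify, and the Lemma-2 function is modified by the same recipe
in every chart; then the refined charts and functions are again compatible. This file proves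
that bookkeeping for families of fans `Δ i ⊆ ℚ^{n i}` with links (`Fan.FamilyLink`,
`LinkedRefinement.lean`), using the transport theorems of `LinkTransport.lean` (res-lit-3) and
the multi-point Lemma 2 of `MultiStarSubdivision.lean` (res-type-037):

* cones: two-sided compatibility after simultaneous star subdivisions through link-closed
  separated point sets is res-lit-3's `Fan.familyLinkCompatible_starIter` (`LinkBridge.lean`);
* `FamilyLink.sum_starCoord_toLin` — **values**: `Σ_{z ∈ Z j} starCoord_z (ℓ x) =
  Σ_{z ∈ Z i} starCoord_z x` for `x ∈ ℓ.src`;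
* `Fan.family_step` — **the synchronised step**: from order functions `f i` on the members,
  link-compatible in cones and values, and such a `Z`, ONE constant `M` such that the functions
  `M f i + Σ_{z ∈ Z i} starCoord_z` are order functions of the subdivided members, again
  link-compatible in cones and values.

References: [KempfEtAl1973] Ch. I §2 Thm. 11 (Lemma 2), Ch. II §1 Def. 5, §2; [Fulton1993Toric] §2.6.
-/

noncomputable section

namespace Literature.Geometry.PolyhedralFans

open PointedCone Finset

namespace Fan

variable {ι : Type*} {n : ι → ℕ} {Δ₀ : ∀ i, Fan ℚ (Fin (n i) → ℚ)}

namespace FamilyLink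

/-- `symm` is an involution. [cite: KempfEtAl1973, Ch. II §1 Def. 5] -/
@[simp] theorem symm_symm (ℓ : FamilyLink n Δ₀) : ℓ.symm.symm = ℓ := by
  cases ℓ; rfl

/-- `toLin` is injective on `src`. [cite: KempfEtAl1973, Ch. II §1 Def. 5] -/
theorem injOn_src (ℓ : FamilyLink n Δ₀) : Set.InjOn ℓ.toLin ℓ.src := fun x hx x' hx' h => by
  rw [← ℓ.left_inv x hx, ← ℓ.left_inv x' hx', h]

/-- **Values after a synchronised step**: for `x ∈ ℓ.src`, the tents of the points of `Z j` at
`ℓ x` sum to the tents of the points of `Z i` at `x` (points off the source/target contribute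
nothing; the others correspond under the link, with equal coordinates by
`starCoord_map_eq_of_compat`). [cite: KempfEtAl1973, Ch. II §2 Thm. 9*] -/
theorem sum_starCoord_toLin (ℓ : FamilyLink n Δ₀) {Δ : ∀ i, Fan ℚ (Fin (n i) → ℚ)}
    (h : FamilyLinkCompatible Δ ℓ) (h' : FamilyLinkCompatible Δ ℓ.symm)
    (hcovi : (ℓ.src : Set (Fin (n ℓ.i) → ℚ)) ⊆ ((Δ ℓ.i).restrict ℓ.src).support)
    (hcovj : (ℓ.tgt : Set (Fin (n ℓ.j) → ℚ)) ⊆ ((Δ ℓ.j).restrict ℓ.tgt).support)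
    (Z : ∀ i, Finset (Fin (n i) → ℚ)) (hZ0 : ∀ i, ∀ z ∈ Z i, z ≠ 0)
    (hcl : ∀ z ∈ Z ℓ.i, z ∈ ℓ.src → ℓ.toLin z ∈ Z ℓ.j)
    (hcl' : ∀ z ∈ Z ℓ.j, z ∈ ℓ.tgt → ℓ.invLin z ∈ Z ℓ.i) {x : Fin (n ℓ.i) → ℚ} (hx : x ∈ ℓ.src) :
    ∑ z ∈ Z ℓ.j, (Δ ℓ.j).starCoord z (ℓ.toLin x) = ∑ z ∈ Z ℓ.i, (Δ ℓ.i).starCoord z x := by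
  classical
  have hEx : ℓ.toLin x ∈ ℓ.tgt := ℓ.mapsTo x hx
  -- only points in the target / source contribute
  rw [← Finset.sum_filter_of_ne (p := fun z => z ∈ (ℓ.tgt : Set (Fin (n ℓ.j) → ℚ)))
        (fun z _ hne => by
          by_contra hz
          exact hne (starCoord_eq_zero_of_not_mem_cone hcovj hEx hz)),
    ← Finset.sum_filter_of_ne (s := Z ℓ.i) (p := fun z => z ∈ (ℓ.src : Set (Fin (n ℓ.i) → ℚ)))
        (fun z _ hne => by
          by_contra hz
          exact hne (starCoord_eq_zero_of_not_mem_cone hcovi hx hz))]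
  -- reindex the source sum along the link
  have hbij : (Z ℓ.j).filter (fun z => z ∈ (ℓ.tgt : Set (Fin (n ℓ.j) → ℚ))) =
      ((Z ℓ.i).filter (fun z => z ∈ (ℓ.src : Set (Fin (n ℓ.i) → ℚ)))).image ℓ.toLin := by
    ext z
    simp only [Finset.mem_filter, Finset.mem_image, SetLike.mem_coe]
    constructor
    · rintro ⟨hzZ, hzt⟩
      exact ⟨ℓ.invLin z, ⟨hcl' z hzZ hzt, ℓ.mapsTo_inv z hzt⟩, ℓ.right_inv z hzt⟩
    · rintro ⟨y, ⟨hyZ, hys⟩, rfl⟩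
      exact ⟨hcl y hyZ hys, ℓ.mapsTo y hys⟩
  rw [hbij, Finset.sum_image (fun y hy y' hy' hyy' =>
    ℓ.injOn_src (Finset.mem_filter.1 hy).2 (Finset.mem_filter.1 hy').2 hyy')]
  refine Finset.sum_congr rfl fun z hz => ?_
  obtain ⟨hzZ, hzs⟩ := Finset.mem_filter.1 hz
  exact Fan.starCoord_eq_of_familyLinkCompatible ℓ hcovi ⟨h, h'⟩ hzs (hZ0 ℓ.i z hzZ) hx

end FamilyLink

/-! ## The synchronised step for the whole family -/

variable [Fintype ι]

/-- **One synchronised subdivision step of a linked family** ([KempfEtAl1973] Ch. II §2): let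
`f i` be non-negative order functions for the subdivisions `Δ i = (Δ₀ i).starIter (l i)` of the
rational fans `Δ₀ i`, compatible with every link of `L` and its inverse in cones and in values;
let `Z i` be finite sets of nonzero lattice vectors, separated in `Δ i`, closed under every link
in both directions, listed without duplicates by `lZ i`. Then for ONE constant `M > 0` the
functions `x ↦ M f i x + Σ_{z ∈ Z i} starCoord_z x` are non-negative order functions for
`(Δ₀ i).starIter (l i ++ lZ i)`, again compatible with every link and its inverse in cones and in
values. [cite: KempfEtAl1973, Ch. II §2 Thm. 11*] -/
theorem family_step (Δ₀ : ∀ i, Fan ℚ (Fin (n i) → ℚ)) (L : Set (FamilyLink n Δ₀))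
    (l : ∀ i, List (Fin (n i) → ℚ)) (f : ∀ i, (Fin (n i) → ℚ) → ℚ)
    (hord : ∀ i, IsOrdFunction (Δ₀ i) ((Δ₀ i).starIter (l i)) (f i)) (hnn : ∀ i x, 0 ≤ f i x)
    (hcompat : ∀ ℓ ∈ L, FamilyLinkCompatible (fun k => (Δ₀ k).starIter (l k)) ℓ ∧
      FamilyLinkCompatible (fun k => (Δ₀ k).starIter (l k)) ℓ.symm ∧
      ∀ x ∈ ℓ.src, f ℓ.j (ℓ.toLin x) = f ℓ.i x)
    (Z : ∀ i, Finset (Fin (n i) → ℚ)) (hZ0 : ∀ i, ∀ z ∈ Z i, z ≠ 0)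
    (hsep : ∀ i, ∀ σ ∈ ((Δ₀ i).starIter (l i)).cones, ∀ z ∈ Z i, ∀ z' ∈ Z i, z ∈ σ → z' ∈ σ → z = z')
    (hclosed : ∀ ℓ ∈ L, (∀ z ∈ Z ℓ.i, z ∈ ℓ.src → ℓ.toLin z ∈ Z ℓ.j) ∧
      (∀ z ∈ Z ℓ.j, z ∈ ℓ.tgt → ℓ.invLin z ∈ Z ℓ.i))
    (lZ : ∀ i, List (Fin (n i) → ℚ)) (hlZnd : ∀ i, (lZ i).Nodup) (hlZ : ∀ i, ∀ z, z ∈ lZ i ↔ z ∈ Z i) :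
    ∃ M : ℚ, 0 < M ∧
      (∀ i, IsOrdFunction (Δ₀ i) ((Δ₀ i).starIter (l i ++ lZ i))
        fun x => M * f i x + ∑ z ∈ Z i, ((Δ₀ i).starIter (l i)).starCoord z x) ∧
      (∀ i x, 0 ≤ M * f i x + ∑ z ∈ Z i, ((Δ₀ i).starIter (l i)).starCoord z x) ∧
      ∀ ℓ ∈ L, FamilyLinkCompatible (fun k => (Δ₀ k).starIter (l k ++ lZ k)) ℓ ∧
        FamilyLinkCompatible (fun k => (Δ₀ k).starIter (l k ++ lZ k)) ℓ.symm ∧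
        ∀ x ∈ ℓ.src, (M * f ℓ.j (ℓ.toLin x) + ∑ z ∈ Z ℓ.j, ((Δ₀ ℓ.j).starIter (l ℓ.j)).starCoord z (ℓ.toLin x)) =
          M * f ℓ.i x + ∑ z ∈ Z ℓ.i, ((Δ₀ ℓ.i).starIter (l ℓ.i)).starCoord z x := by
  classical
  set Δ : ∀ i, Fan ℚ (Fin (n i) → ℚ) := fun k => (Δ₀ k).starIter (l k) with hΔ
  -- one constant for all members
  have hB := fun i => (hord i).multiStar_bound (hZ0 i) (hsep i)
  choose B hBpos hB using hB
  set M : ℚ := 1 + ∑ i, B i with hM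
  have hBnn : ∀ i ∈ (Finset.univ : Finset ι), 0 ≤ B i := fun i _ => (hBpos i).le
  have hMpos : 0 < M := by
    have := Finset.sum_nonneg hBnn
    rw [hM]; linarith
  have hMB : ∀ i, B i ≤ M := fun i => by
    have h1 : B i ≤ ∑ k, B k := Finset.single_le_sum hBnn (Finset.mem_univ i)
    rw [hM]; linarith
  have hnew : (fun k => (Δ₀ k).starIter (l k ++ lZ k)) = fun k => (Δ k).starIter (lZ k) := by
    funext k; rw [starIter_append]
  have hcov : ∀ k, ∀ ⦃σ⦄, σ ∈ (Δ₀ k).cones → (σ : Set (Fin (n k) → ℚ)) ⊆ ((Δ k).restrict σ).support := by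
    intro k σ hσ
    obtain ⟨-, -, hsub⟩ := hord k hσ
    exact hsub
  -- cones: two-sided compatibility after the step (res-lit-3's bridge)
  have hboth : ∀ ℓ ∈ L, FamilyLinkCompatible (fun k => (Δ k).starIter (lZ k)) ℓ ∧
      FamilyLinkCompatible (fun k => (Δ k).starIter (lZ k)) ℓ.symm := by
    intro ℓ hℓ
    obtain ⟨hc, hc', -⟩ := hcompat ℓ hℓ
    obtain ⟨hcl, hcl'⟩ := hclosed ℓ hℓ
    refine Fan.familyLinkCompatible_starIter ℓ (hcov ℓ.i ℓ.src_mem) ⟨hc, hc'⟩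
      (fun z hz => hZ0 _ z ((hlZ _ z).1 hz)) (fun z hz => hZ0 _ z ((hlZ _ z).1 hz))
      (hlZnd _) (hlZnd _) (fun w => ?_) (fun σ hσ w hw w' hw' => hsep ℓ.j σ hσ w ((hlZ _ w).1 hw) w' ((hlZ _ w').1 hw'))
    rw [hlZ]
    constructor
    · rintro ⟨hwZ, hwt⟩
      exact ⟨ℓ.invLin w, (hlZ _ _).2 (hcl' w hwZ hwt), ℓ.mapsTo_inv w hwt, ℓ.right_inv w hwt⟩
    · rintro ⟨z, hz, hzs, rfl⟩
      exact ⟨hcl z ((hlZ _ z).1 hz) hzs, ℓ.mapsTo z hzs⟩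
  refine ⟨M, hMpos, fun i => ?_, fun i x => ?_, fun ℓ hℓ => ⟨?_, ?_, fun x hx => ?_⟩⟩
  · rw [starIter_append]
    exact hB i M (hMB i) (lZ i) (hlZnd i) (hlZ i)
  · exact add_nonneg (mul_nonneg hMpos.le (hnn i x)) (Finset.sum_nonneg fun z _ => starCoord_nonneg z x)
  · rw [hnew]; exact (hboth ℓ hℓ).1
  · rw [hnew]; exact (hboth ℓ hℓ).2
  · obtain ⟨hc, hc', hval⟩ := hcompat ℓ hℓ
    obtain ⟨hcl, hcl'⟩ := hclosed ℓ hℓ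
    rw [hval x hx, ℓ.sum_starCoord_toLin hc hc' (hcov ℓ.i ℓ.src_mem) (hcov ℓ.j ℓ.tgt_mem) Z hZ0
      hcl hcl' hx]

end Fan

end Literature.Geometry.PolyhedralFans
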